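import Summits.Ventures.LatticeQCDFlow.Scaling.LumpedStarStepFloor
import Summits.Ventures.LatticeQCDFlow.Scaling.LumpedStarStepMixingTime
import Literature.Probability.MarkovChains.ConvergenceTheorem

/-!
HONEST FRAMING: exact (Metropolis-corrected) sampling algorithms for lattice gauge theory; figures
of merit are autocorrelation/cost numbers at stated couplings and volumes; no continuum-physics
claim.

# LumpedStarStepFloorSymmetric — THE HALF-MASS HYPOTHESIS OF THE STEP FLOOR DISCHARGED BY A CONTENT SYMMETRY: IF A PERMUTATION `τ` OF THE CONTENTS PRESERVES `μ_0` AND `W` AND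
# MOVES `u`, THE `u`-CROWDED COMPOSITIONS `{N(u) > (K+1)/2}` CARRY AT MOST HALF OF `π_S`, SO `t_mix^{steps}(1/4) ≥ (K+1)/(8(1−σ))` AND `≥ (K−7)/(8σ)` — A TWO-SIDED WITNESS FOR THE
# STEP LAW OF CHAPTER AD (lean-2 GEN-44, ours)

Venture-side (OURS).  Cell `lqcd-flow` (pub-lqcd), unit `pub-lqcd-lean-2-g44`, 2026-08-31.  Chapter AD, file 7.  File 6 (`lumpedStar_step_mixingTime_ge`) needs
`π_S{fewer than m particles off u} ≤ ½`.  Here: a permutation `τ` of `S` induces the state map `x ↦ x^τ` (`hub x^τ = τ⁻¹(hub x)`, `comp x^τ = comp x ∘ τ`; it exists and is unique by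
X5's `hsurj`/`hinj`), which is injective, preserves X5's stationary law `π_S(x) ∝ g(comp x)·comp x(hub x)/W_{hub x}` when `μ_0 ∘ τ = μ_0` and `W ∘ τ = W`, and maps `{N(u) > (K+1)/2}` into
`{N(τ⁻¹u) > (K+1)/2}`, disjoint from it when `τu ≠ u` (two contents cannot both hold more than half of the `K+1` particles); hence the half-mass bound with `m = (K+1)/2`, and file 6
gives the floor; the `¼`-closeness at some time that file 6 asks for is LPW Thm 4.9 (in the tree) on X7's irreducibility and aperiodicity (`S(x,x) ≥ (1−σ)μ_0(hub x) > 0`).  With chapter AD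
file 4 this is a TWO-SIDED law in steps for every such symmetric lumped star, with NO further hypothesis: `Ω(K·max{1/σ, 1/(1−σ)})` against `O((K/((1−σ)σp̄))·log(K/(σp̄ε)))`.

* `symmState_exists`, `symmState_unique`, `lumpedStar_piS_symm` (invariance of X5's `π_S`), `crowded_mass_le_half`, **`lumpedStar_step_mixingTime_ge_symmetric`**.

Literature grade (cell rule): OWN, elementary; nothing cited; no new bib keys.
-/

open Finset
open Literature.Probability.MarkovChains

namespace Summit.Ventures.LatticeQCDFlow.Scaling

section StepFloorSymm
variable {X : Type*} [Fintype X] [DecidableEq X] {S : Type*} [Fintype S] [DecidableEq S]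
variable {hub : X → S} {comp : X → S → ℕ} {K : ℕ} {μ0 W : S → ℝ} {σ : ℝ} {acc : S → S → ℝ} {Kh : (S → ℕ) → S → S → ℝ}
variable {Ast Bst Sst : X → X → ℝ} {g : (S → ℕ) → ℝ} {πS : X → ℝ} {Z : ℝ}

omit [Fintype X] [DecidableEq X] [DecidableEq S] in
/-- The symmetric image of a state exists. [ours] -/
theorem symmState_exists (hsurj : ∀ (z : S) (N : S → ℕ), ∑ v, N v = K + 1 → N z ≠ 0 → ∃ x, hub x = z ∧ comp x = N) (hhub : ∀ x, comp x (hub x) ≠ 0)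
    (hsum : ∀ x, ∑ v, comp x v = K + 1) (τ : S ≃ S) (x : X) : ∃ y, hub y = τ.symm (hub x) ∧ comp y = comp x ∘ τ := by
  refine hsurj (τ.symm (hub x)) (comp x ∘ τ) ?_ ?_
  · rw [show (∑ v, (comp x ∘ τ) v) = ∑ v, comp x (τ v) from rfl, Equiv.sum_comp τ (comp x), hsum]
  · simp only [Function.comp, Equiv.apply_symm_apply]; exact hhub x

omit [Fintype X] [DecidableEq X] [Fintype S] [DecidableEq S] in
/-- Two states with the same symmetric image data coincide with each other's preimage: injectivity of `x ↦ x^τ`. [ours] -/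
theorem symmState_unique (hinj : ∀ x x', hub x = hub x' → comp x = comp x' → x = x') (τ : S ≃ S) {x x' y : X}
    (hy : hub y = τ.symm (hub x) ∧ comp y = comp x ∘ τ) (hy' : hub y = τ.symm (hub x') ∧ comp y = comp x' ∘ τ) : x = x' := by
  refine hinj x x' (τ.symm.injective (hy.1.symm.trans hy'.1)) ?_
  have h := hy.2.symm.trans hy'.2
  funext v
  have := congr_fun h (τ.symm v)
  simpa [Function.comp, Equiv.apply_symm_apply] using this

omit [Fintype X] [DecidableEq X] [DecidableEq S] in
/-- **X5's stationary law is invariant under a content symmetry preserving `μ_0` and `W`.** [ours] -/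
theorem lumpedStar_piS_symm (hg : ∀ N, g N = ∏ v, (μ0 v * W v) ^ (N v) / ((N v).factorial : ℝ))
    (hπS : ∀ x, πS x = g (comp x) * ((comp x (hub x) : ℝ) / W (hub x)) / Z)
    (τ : S ≃ S) (hμτ : ∀ v, μ0 (τ v) = μ0 v) (hWτ : ∀ v, W (τ v) = W v) {x y : X} (hy : hub y = τ.symm (hub x) ∧ comp y = comp x ∘ τ) : πS y = πS x := by
  rw [hπS, hπS, hy.1, hy.2]
  have hgτ : g (comp x ∘ τ) = g (comp x) := by
    rw [hg, hg]
    rw [show (∏ v, (μ0 v * W v) ^ ((comp x ∘ τ) v) / (((comp x ∘ τ) v).factorial : ℝ)) = ∏ v, (μ0 (τ v) * W (τ v)) ^ (comp x (τ v)) / ((comp x (τ v)).factorial : ℝ) from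
      prod_congr rfl fun v _ => by rw [hμτ, hWτ]; rfl]
    exact Equiv.prod_comp τ (fun w => (μ0 w * W w) ^ (comp x w) / ((comp x w).factorial : ℝ))
  have hc : (comp x ∘ τ) (τ.symm (hub x)) = comp x (hub x) := by simp [Function.comp]
  have hW' : W (τ.symm (hub x)) = W (hub x) := by conv_rhs => rw [← τ.apply_symm_apply (hub x)]; rw [hWτ]
  rw [hgτ, hc, hW']

/-- **The `u`-crowded compositions carry at most half the mass** of any probability vector invariant under the symmetry, when `τu ≠ u`. [ours] -/
theorem crowded_mass_le_half (hinj : ∀ x x', hub x = hub x' → comp x = comp x' → x = x')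
    (hsurj : ∀ (z : S) (N : S → ℕ), ∑ v, N v = K + 1 → N z ≠ 0 → ∃ x, hub x = z ∧ comp x = N) (hhub : ∀ x, comp x (hub x) ≠ 0)
    (hsum : ∀ x, ∑ v, comp x v = K + 1) (τ : S ≃ S) {u : S} (hu : τ u ≠ u)
    {π : X → ℝ} (hπ0 : ∀ x, 0 ≤ π x) (hπ1 : ∑ x, π x = 1) (hπτ : ∀ x y, hub y = τ.symm (hub x) → comp y = comp x ∘ τ → π y = π x) :
    ∑ x ∈ univ.filter (fun x => ((K : ℝ) + 1) - (comp x u : ℝ) < ((K : ℝ) + 1) / 2), π x ≤ 1 / 2 := by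
  classical
  -- the state map
  choose f hf using symmState_exists hsurj hhub hsum τ
  have hfinj : Function.Injective f := fun x x' h => symmState_unique hinj τ (hf x) (h ▸ hf x')
  set E := univ.filter (fun x => ((K : ℝ) + 1) - (comp x u : ℝ) < ((K : ℝ) + 1) / 2) with hE
  set E' := univ.filter (fun x => ((K : ℝ) + 1) - (comp x (τ.symm u) : ℝ) < ((K : ℝ) + 1) / 2) with hE'
  -- `f(E) ⊆ E'`
  have himg : E.image f ⊆ E' := by
    intro y hy
    obtain ⟨x, hx, rfl⟩ := mem_image.mp hy
    have hxE := (mem_filter.mp hx).2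
    refine mem_filter.mpr ⟨mem_univ _, ?_⟩
    have : comp (f x) (τ.symm u) = comp x u := by rw [(hf x).2]; simp [Function.comp]
    rw [this]; exact hxE
  -- `E ∩ E' = ∅`
  have hdisj : Disjoint E E' := by
    rw [Finset.disjoint_filter]
    intro x _ h1 h2
    have hne : u ≠ τ.symm u := fun e => hu ((congrArg τ e).trans (τ.apply_symm_apply u))
    have hle : comp x u + comp x (τ.symm u) ≤ K + 1 := by
      rw [← hsum x, ← Finset.sum_pair hne]
      exact Finset.sum_le_sum_of_subset_of_nonneg (subset_univ _) fun _ _ _ => Nat.zero_le _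
    have hle' : (comp x u : ℝ) + (comp x (τ.symm u) : ℝ) ≤ K + 1 := by exact_mod_cast hle
    linarith
  -- masses
  have h1 : ∑ x ∈ E, π x = ∑ y ∈ E.image f, π y := by
    rw [Finset.sum_image fun x _ x' _ h => hfinj h]
    exact sum_congr rfl fun x _ => (hπτ x (f x) (hf x).1 (hf x).2).symm
  have h2 : ∑ y ∈ E.image f, π y ≤ ∑ y ∈ E', π y := Finset.sum_le_sum_of_subset_of_nonneg himg fun y _ _ => hπ0 y
  have h3 : ∑ x ∈ E, π x + ∑ y ∈ E', π y ≤ 1 := by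
    rw [← Finset.sum_union hdisj, ← hπ1]
    exact Finset.sum_le_sum_of_subset_of_nonneg (subset_univ _) fun x _ _ => hπ0 x
  linarith

/-- **A TWO-SIDED WITNESS: THE STEP FLOOR FOR A SYMMETRIC LUMPED STAR, UNCONDITIONAL.**  If a permutation of the contents preserves `μ_0` and `W` and moves `u`, then for
`0 < σ < 1`: `t_mix(1/4) ≥ (K+1)/(8(1−σ))` and `t_mix(1/4) ≥ (K−7)/(8σ)`. [ours] -/
theorem lumpedStar_step_mixingTime_ge_symmetric [Nonempty X] (hinj : ∀ x x', hub x = hub x' → comp x = comp x' → x = x')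
    (hsurj : ∀ (z : S) (N : S → ℕ), ∑ v, N v = K + 1 → N z ≠ 0 → ∃ x, hub x = z ∧ comp x = N) (hhub : ∀ x, comp x (hub x) ≠ 0)
    (hsum : ∀ x, ∑ v, comp x v = K + 1) (hK : 1 ≤ K) (hW : ∀ v, 0 < W v) (hacc : ∀ h v, acc h v = min 1 (W h / W v)) (hμ1 : ∑ v, μ0 v = 1) (hμpos : ∀ v, 0 < μ0 v)
    (hσ0 : 0 < σ) (hσ1 : σ < 1)
    (hKoff : ∀ N h v, h ≠ v → Kh N h v = if N h = 0 then 0 else (N v : ℝ) / K * acc h v) (hKdiag : ∀ N h, Kh N h h = 1 - ∑ v ∈ univ.erase h, Kh N h v)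
    (hA : ∀ x x', Ast x x' = if comp x' = comp x then Kh (comp x) (hub x) (hub x') else 0)
    (hB : ∀ x x', Bst x x' = μ0 (hub x') * (if comp x' + Pi.single (hub x) 1 = comp x + Pi.single (hub x') 1 then 1 else 0))
    (hS : ∀ x x', Sst x x' = σ * Ast x x' + (1 - σ) * Bst x x')
    (hg : ∀ N, g N = ∏ v, (μ0 v * W v) ^ (N v) / ((N v).factorial : ℝ))
    (hZ : Z = ∑ x, g (comp x) * ((comp x (hub x) : ℝ) / W (hub x))) (hπS : ∀ x, πS x = g (comp x) * ((comp x (hub x) : ℝ) / W (hub x)) / Z)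
    (τ : S ≃ S) (hμτ : ∀ v, μ0 (τ v) = μ0 v) (hWτ : ∀ v, W (τ v) = W v) {u : S} (hu : τ u ≠ u) :
    ((K : ℝ) + 1) / (8 * (1 - σ)) ≤ (mixingTime Sst πS (1 / 4) : ℝ) ∧ ((K : ℝ) - 7) / (8 * σ) ≤ (mixingTime Sst πS (1 / 4) : ℝ) := by
  classical
  have hμ0 : ∀ v, 0 ≤ μ0 v := fun v => (hμpos v).le
  have hπ := lumpedStar_piS_pos hhub hW hμpos hg hZ hπS
  have hπ1 := lumpedStar_piS_sum hhub hW hμpos hg hZ hπS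
  have hA0 : ∀ x x', 0 ≤ Ast x x' := starStep_swap_nonneg hW hacc hK hsum hKoff hKdiag hA
  have hA1 : ∀ x, ∑ x', Ast x x' = 1 := starStep_swap_rowsum hinj hsurj hhub hsum hKoff hKdiag hA
  have hB0 : ∀ x x', 0 ≤ Bst x x' := fun x x' => by rw [hB]; exact mul_nonneg (hμ0 _) (by split_ifs <;> norm_num)
  have hB1 : ∀ x, ∑ x', Bst x x' = 1 := starStep_redraw_rowsum hinj hsurj hhub hsum hμ1 hB
  have hArev : ∀ x x', πS x * Ast x x' = πS x' * Ast x' x := starStep_swap_reversible hinj hhub hW hacc hKoff hA hπS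
  have hBrev : ∀ x x', πS x * Bst x x' = πS x' * Bst x' x := starStep_redraw_reversible hhub hW hg hπS hB
  have hSrs : IsRowStochastic Sst := by
    refine ⟨fun x y => by rw [hS]; exact add_nonneg (mul_nonneg hσ0.le (hA0 x y)) (mul_nonneg (by linarith) (hB0 x y)), fun x => ?_⟩
    simp_rw [hS]; rw [sum_add_distrib, ← mul_sum, ← mul_sum, hA1, hB1]; ring
  have hst : IsStationary πS Sst := by
    intro y
    calc ∑ x, πS x * Sst x y = ∑ x, (σ * (πS y * Ast y x) + (1 - σ) * (πS y * Bst y x)) :=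
          sum_congr rfl fun x _ => by rw [hS, ← hArev, ← hBrev]; ring
      _ = σ * (πS y * ∑ x, Ast y x) + (1 - σ) * (πS y * ∑ x, Bst y x) := by rw [sum_add_distrib, ← mul_sum, ← mul_sum, ← mul_sum, ← mul_sum]
      _ = πS y := by rw [hA1, hB1]; ring
  -- `¼`-close at some time: irreducible (X7) and aperiodic (`S(x,x) > 0`), LPW Thm 4.9
  have hirr := lumpedStar_step_irreducible hsurj hhub hW hacc hK hsum hKoff hKdiag hμpos hσ0 hσ1 hA hB hS
  have hap : IsAperiodic Sst := isAperiodic_of_diag_pos fun x => by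
    rw [hS]
    have hBxx : Bst x x = μ0 (hub x) := by rw [hB, if_pos rfl, mul_one]
    have : 0 < (1 - σ) * Bst x x := by rw [hBxx]; exact mul_pos (by linarith) (hμpos _)
    have := mul_nonneg hσ0.le (hA0 x x)
    linarith
  have hmix : ∃ t₀, worstTvDist Sst πS t₀ ≤ 1 / 4 := exists_worstTvDist_le hSrs hirr hap hst (fun x => (hπ x).le) hπ1 (by norm_num)
  have hhalf := crowded_mass_le_half hinj hsurj hhub hsum τ hu (fun x => (hπ x).le) hπ1
    (fun x y h1 h2 => lumpedStar_piS_symm hg hπS τ hμτ hWτ ⟨h1, h2⟩)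
  have hm : (0 : ℝ) < ((K : ℝ) + 1) / 2 := by positivity
  have ha : ∀ h, h ≠ u → acc h u ≤ 1 := fun h _ => by rw [hacc]; exact min_le_left _ _
  have h := lumpedStar_step_mixingTime_ge hinj hsurj hhub hsum hKoff hμ0 hσ0.le hσ1.le hA hA0 hA1 hB hB1 hS hπ1 hst u zero_le_one ha hm hhalf hmix
  refine ⟨?_, ?_⟩
  · have := h.1 hσ1
    rw [show ((K : ℝ) + 1) / (8 * (1 - σ)) = ((K : ℝ) + 1) / 2 / (4 * (1 - σ)) by field_simp; ring]; exact this
  · have := h.2 (by rw [mul_one]; exact hσ0)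
    rw [show ((K : ℝ) - 7) / (8 * σ) = (((K : ℝ) + 1) / 2 - 4) / (4 * (σ * 1)) by field_simp; ring]; exact this

end StepFloorSymm

end Summit.Ventures.LatticeQCDFlow.Scaling
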